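import Literature.Algebra.Polynomial.CasasAlvero.PrimePower
import Mathlib.Data.Nat.Choose.Lucas
import Mathlib.Algebra.Polynomial.Expand
import Mathlib.Algebra.CharP.Frobenius
import Mathlib.Tactic.LinearCombination
import HarnessLib

/-!
# Casas-Alvero in characteristic `p`: degree `n` ⇒ degree `n · p^k` (Graf von Bothmer–Labs–Schicho–van de Woestijne)

[GvBLSW 2007] = H.-C. Graf von Bothmer, O. Labs, J. Schicho, C. van de Woestijne, *The Casas-Alvero
conjecture for infinitely many degrees*, J. Algebra 316 (2007) 224–230, arXiv:math/0605090.

PROVED here (no `sorry`, no new axioms), continuing `PrimePower.lean`: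
* `holdsInDegree_mul_prime_pow` — **[GvBLSW 2007, Prop. 6] in full**: over a perfect ring `R` of prime
  characteristic `p`, if the Casas-Alvero property holds in degree `n` (`HoldsInDegree R n`) then it
  holds in degree `n · p^k`.  Proof as in the paper: (1) `coeff_eq_zero_of_natDegree_eq_mul_prime_pow` —
  a Casas-Alvero polynomial of degree `n p^k` has `[X^i] f = 0` whenever `p^k ∤ i` (downward induction;
  the binomials `C(j, i)` with `p^k ∣ j`, `p^k ∤ i` vanish mod `p` by Lucas, `cast_choose_eq_zero_of_pow_dvd`);
  (2) hence `f = Q^(p^k)` for the explicit `Q = rootPoly p k n f` (`rootPoly_pow`; perfectness gives the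
  `p^k`-th roots of the coefficients); (3) `hasseDeriv_mul_prime_pow_pow` — in characteristic `p`,
  `H_{j p^k}(Q^(p^k)) = (H_j Q)^(p^k)` (Lucas again: `C(a p^k, b p^k) ≡ C(a, b)`), so `Q` is again
  Casas-Alvero, monic of degree `n`, whence `Q = (X - a)^n` and `f = (X - a)^(n p^k)`.
* `holdsInDegree_one`, `holdsInDegree_two` — [GvBLSW 2007, Prop. 3] degrees `1` and `2` over ANY
  commutative ring (so `holdsInDegree_two_mul_prime_pow` of `PrimePower.lean` is also the case `n = 2`
  of Prop. 6, and `holdsInDegree_prime_pow` the case `n = 1`).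
* `holdsInDegree_three` — degree `3` over a field in which `6 ≠ 0`, and hence
  `holdsInDegree_three_mul_prime_pow` — degree `3 · p^k` over a perfect field of characteristic `p ≥ 5`
  (the characteristic-`p` half of the known case `d = 3p^k`; cf. [Castryck–Laterveer–Ounaïes 2014, §1]).
NOT formalised: [GvBLSW 2007, Prop. 2] (lifting from `𝔽̄_p` to characteristic `0`).
-/

noncomputable section

open Polynomial

namespace Literature.Algebra.Polynomial.CasasAlvero

variable {R : Type*} [CommRing R]

section Lucas

variable (p : ℕ) [hp : Fact p.Prime]

/-- Lucas: `C(j, i) ≡ 0 (mod p)` when `p^k ∣ j` and `p^k ∤ i` (Lucas 1878). [folklore] -/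
theorem choose_modEq_zero_of_pow_dvd {k j i : ℕ} (hj : p ^ k ∣ j) (hi : ¬ p ^ k ∣ i) :
    j.choose i ≡ 0 [MOD p] := by
  induction k generalizing j i with
  | zero => exact absurd (by rw [pow_zero]; exact one_dvd i) hi
  | succ k ih =>
    have hpj : p ∣ j := (dvd_pow_self p (Nat.succ_ne_zero k)).trans hj
    have hj0 : j % p = 0 := Nat.mod_eq_zero_of_dvd hpj
    have step := Choose.choose_modEq_choose_mod_mul_choose_div_nat (n := j) (k := i) (p := p)
    rw [hj0] at step
    by_cases hpi : p ∣ i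
    · have hj' : p ^ k ∣ j / p := by
        obtain ⟨m, rfl⟩ := hj
        rw [pow_succ', mul_assoc, Nat.mul_div_cancel_left _ hp.out.pos]
        exact dvd_mul_right _ _
      have hi' : ¬ p ^ k ∣ i / p := by
        rintro ⟨m, hm⟩
        apply hi
        obtain ⟨c, rfl⟩ := hpi
        rw [Nat.mul_div_cancel_left _ hp.out.pos] at hm
        exact ⟨m, by rw [hm, pow_succ']; ring⟩
      calc j.choose i ≡ (0 : ℕ).choose (i % p) * (j / p).choose (i / p) [MOD p] := step
        _ ≡ (0 : ℕ).choose (i % p) * 0 [MOD p] := Nat.ModEq.mul_left _ (ih hj' hi')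
        _ = 0 := by rw [mul_zero]
    · have hi0 : 0 < i % p := Nat.pos_of_ne_zero fun h => hpi (Nat.dvd_of_mod_eq_zero h)
      calc j.choose i ≡ (0 : ℕ).choose (i % p) * (j / p).choose (i / p) [MOD p] := step
        _ = 0 := by rw [Nat.choose_eq_zero_of_lt hi0, zero_mul]

/-- Lucas: `C(a p^k, b p^k) ≡ C(a, b) (mod p)` (Lucas 1878). [folklore] -/
theorem choose_mul_pow_modEq (k a b : ℕ) : (a * p ^ k).choose (b * p ^ k) ≡ a.choose b [MOD p] := by
  induction k with
  | zero => rw [pow_zero, mul_one, mul_one]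
  | succ k ih =>
    have step := Choose.choose_modEq_choose_mod_mul_choose_div_nat
      (n := a * p ^ (k + 1)) (k := b * p ^ (k + 1)) (p := p)
    have h1 : a * p ^ (k + 1) % p = 0 := by rw [pow_succ, ← mul_assoc]; exact Nat.mul_mod_left _ _
    have h2 : b * p ^ (k + 1) % p = 0 := by rw [pow_succ, ← mul_assoc]; exact Nat.mul_mod_left _ _
    have h3 : a * p ^ (k + 1) / p = a * p ^ k := by
      rw [pow_succ, ← mul_assoc, Nat.mul_div_cancel _ hp.out.pos]
    have h4 : b * p ^ (k + 1) / p = b * p ^ k := by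
      rw [pow_succ, ← mul_assoc, Nat.mul_div_cancel _ hp.out.pos]
    rw [h1, h2, h3, h4, Nat.choose_zero_right, one_mul] at step
    exact step.trans ih

variable [CharP R p]

variable (R) in
/-- In characteristic `p`: `C(j, i) = 0` in `R` when `p^k ∣ j` and `p^k ∤ i`. [folklore] -/
theorem cast_choose_eq_zero_of_pow_dvd {k j i : ℕ} (hj : p ^ k ∣ j) (hi : ¬ p ^ k ∣ i) :
    ((j.choose i : ℕ) : R) = 0 :=
  (CharP.cast_eq_zero_iff R p _).mpr (Nat.modEq_zero_iff_dvd.mp (choose_modEq_zero_of_pow_dvd p hj hi))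

variable (R) in
/-- In characteristic `p`: `C(a p^k, b p^k) = C(a, b)` in `R`. [folklore] -/
theorem cast_choose_mul_pow (k a b : ℕ) :
    (((a * p ^ k).choose (b * p ^ k) : ℕ) : R) = (a.choose b : ℕ) :=
  CharP.natCast_eq_natCast' R p (choose_mul_pow_modEq p k a b)

end Lucas

section CharP

variable (p : ℕ) [hp : Fact p.Prime] [CharP R p]

/-- A Casas-Alvero polynomial of degree `n p^k` in characteristic `p` has `[X^i] f = 0` for every `i`
not divisible by `p^k` (first step of the proof). [cite: GrafVonBothmerEtAl2007, Prop. 6] -/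
theorem coeff_eq_zero_of_natDegree_eq_mul_prime_pow {f : R[X]} {n k : ℕ}
    (hd : f.natDegree = n * p ^ k) (hca : IsCasasAlvero f) {i : ℕ} (hi : ¬ p ^ k ∣ i) :
    f.coeff i = 0 := by
  generalize hD : n * p ^ k = D at hd
  have hDdvd : p ^ k ∣ D := hD ▸ Dvd.intro_left _ rfl
  rcases lt_or_ge i D with hlt | hge
  swap
  · rcases hge.eq_or_lt with h | h
    · exact absurd (h ▸ hDdvd) hi
    · exact coeff_eq_zero_of_natDegree_lt (by rw [hd]; exact h)
  suffices H : ∀ m i, i + m + 1 = D → ¬ p ^ k ∣ i → f.coeff i = 0 from H (D - 1 - i) i (by omega) hi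
  intro m
  induction m using Nat.strong_induction_on with
  | _ m ih =>
    intro i him hi
    have hi0 : 0 < i := Nat.pos_of_ne_zero (by rintro rfl; exact hi (dvd_zero _))
    refine coeff_eq_zero_of_sharesRoot_of_hasseDeriv_eq_C ?_ (hca i hi0 (by rw [hd]; omega))
    apply hasseDeriv_eq_C_of_coeff
    intro j hij
    by_cases hpj : p ^ k ∣ j
    · rw [cast_choose_eq_zero_of_pow_dvd R p hpj hi, zero_mul]
    · rcases lt_or_ge j D with hjlt | hjge
      · rw [ih (D - 1 - j) (by omega) j (by omega) hpj, mul_zero]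
      · have hne : j ≠ D := by rintro rfl; exact hpj hDdvd
        rw [coeff_eq_zero_of_natDegree_lt (by rw [hd]; omega), mul_zero]

/-- In characteristic `p`, the coefficients of a `p^k`-th power: `[X^m] (g^(p^k)) = ([X^(m/p^k)] g)^(p^k)`
if `p^k ∣ m`, else `0`. [folklore] -/
theorem coeff_pow_prime_pow (g : R[X]) (k m : ℕ) :
    (g ^ p ^ k).coeff m = if p ^ k ∣ m then (g.coeff (m / p ^ k)) ^ p ^ k else 0 := by
  rw [← map_iterateFrobenius_expand p g k, coeff_map, coeff_expand (pow_pos hp.out.pos k)]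
  split_ifs with h
  · rw [iterateFrobenius_def]
  · rw [map_zero]

/-- Natural-number constants are fixed by the `p^k`-power map in characteristic `p`. [folklore] -/
theorem natCast_pow_prime_pow (c k : ℕ) : ((c : R)) ^ p ^ k = c := by
  rw [← iterateFrobenius_def (p := p), map_natCast]

/-- In characteristic `p`, `H_{j p^k} (g^(p^k)) = (H_j g)^(p^k)` — the step "`Q` again must have a
common factor with all its Hasse derivatives" of the proof. [cite: GrafVonBothmerEtAl2007, Prop. 6] -/
theorem hasseDeriv_mul_prime_pow_pow (g : R[X]) (k j : ℕ) :
    hasseDeriv (j * p ^ k) (g ^ p ^ k) = (hasseDeriv j g) ^ p ^ k := by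
  have hq : 0 < p ^ k := pow_pos hp.out.pos k
  ext m
  rw [hasseDeriv_coeff, coeff_pow_prime_pow p, coeff_pow_prime_pow p, hasseDeriv_coeff]
  by_cases hm : p ^ k ∣ m
  · obtain ⟨a, rfl⟩ := hm
    have e1 : p ^ k * a + j * p ^ k = (a + j) * p ^ k := by ring
    have h1 : p ^ k ∣ p ^ k * a + j * p ^ k := ⟨a + j, by ring⟩
    rw [if_pos h1, if_pos (dvd_mul_right _ _), Nat.mul_div_cancel_left _ hq, e1,
      Nat.mul_div_cancel _ hq, cast_choose_mul_pow R p k (a + j) j, mul_pow,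
      natCast_pow_prime_pow p]
  · have h1 : ¬ p ^ k ∣ m + j * p ^ k := fun h =>
      hm ((Nat.dvd_add_right (dvd_mul_left (p ^ k) j)).mp (by rwa [add_comm] at h))
    rw [if_neg h1, if_neg hm, mul_zero]

variable [PerfectRing R p]

/-- The candidate `p^k`-th root of a degree-`n p^k` polynomial supported on multiples of `p^k`:
`Q = Σ_{j ≤ n} φ^{-k}([X^(j p^k)] f) · X^j`, `φ` the Frobenius (the `Q` of the proof).
[cite: GrafVonBothmerEtAl2007, Prop. 6] -/
def rootPoly (k n : ℕ) (f : R[X]) : R[X] :=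
  ∑ j ∈ Finset.range (n + 1), C ((iterateFrobeniusEquiv R p k).symm (f.coeff (j * p ^ k))) * X ^ j

/-- Coefficients of `rootPoly`. [folklore] -/
theorem coeff_rootPoly (k n : ℕ) (f : R[X]) (j : ℕ) :
    (rootPoly p k n f).coeff j =
      if j ≤ n then (iterateFrobeniusEquiv R p k).symm (f.coeff (j * p ^ k)) else 0 := by
  simp only [rootPoly, finsetSum_coeff, coeff_C_mul_X_pow, Finset.sum_ite_eq, Finset.mem_range,
    Nat.lt_succ_iff]

/-- `rootPoly p k n f` has degree at most `n`. [folklore] -/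
theorem natDegree_rootPoly_le (k n : ℕ) (f : R[X]) : (rootPoly p k n f).natDegree ≤ n := by
  unfold rootPoly
  refine natDegree_sum_le_of_forall_le _ _ fun j hj => ?_
  exact (natDegree_C_mul_X_pow_le _ _).trans (Nat.lt_succ_iff.mp (Finset.mem_range.mp hj))

/-- For monic `f` of degree `n p^k`, the `X^n`-coefficient of `rootPoly p k n f` is `1`. [folklore] -/
theorem coeff_rootPoly_self {f : R[X]} {n k : ℕ} (hf : f.Monic) (hd : f.natDegree = n * p ^ k) :
    (rootPoly p k n f).coeff n = 1 := by
  rw [coeff_rootPoly, if_pos le_rfl, ← hd, hf.coeff_natDegree, map_one]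

/-- `f = Q^(p^k)` with `Q = rootPoly p k n f`, for `f` of degree `n p^k` supported on multiples of `p^k`,
over a perfect ring of characteristic `p`. [cite: GrafVonBothmerEtAl2007, Prop. 6] -/
theorem rootPoly_pow {f : R[X]} {n k : ℕ} (hd : f.natDegree = n * p ^ k)
    (hc : ∀ i, ¬ p ^ k ∣ i → f.coeff i = 0) : (rootPoly p k n f) ^ p ^ k = f := by
  have hq : 0 < p ^ k := pow_pos hp.out.pos k
  ext m
  rw [coeff_pow_prime_pow p, coeff_rootPoly]
  split_ifs with hm hle
  · rw [← iterateFrobeniusEquiv_def, RingEquiv.apply_symm_apply, Nat.div_mul_cancel hm]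
  · rw [zero_pow hq.ne', eq_comm]
    apply coeff_eq_zero_of_natDegree_lt
    rw [hd]
    have h1 : (n + 1) * p ^ k ≤ m := (Nat.le_div_iff_mul_le hq).mp (not_le.mp hle)
    nlinarith
  · exact (hc m hm).symm

/-- In a perfect ring of characteristic `p`, `x^(p^k) = 0 → x = 0`. [folklore] -/
theorem eq_zero_of_pow_prime_pow_eq_zero {x : R} {k : ℕ} (h : x ^ p ^ k = 0) : x = 0 := by
  rw [← iterateFrobenius_def (p := p)] at h
  exact (bijective_iterateFrobenius R p k).1 (by rw [h, map_zero])

/-- **GvBLSW Prop. 6** — if the Casas-Alvero property holds in degree `n` over a perfect ring `R` of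
characteristic `p` (e.g. `𝔽̄_p`), then it holds in degree `n · p^k` over `R`.
[cite: GrafVonBothmerEtAl2007, Prop. 6] -/
theorem holdsInDegree_mul_prime_pow {n : ℕ} (hn : HoldsInDegree R n) (k : ℕ) :
    HoldsInDegree R (n * p ^ k) := by
  intro f hf hd hca
  cases subsingleton_or_nontrivial R with
  | inl _ => exact ⟨0, Subsingleton.elim _ _⟩
  | inr _ =>
    have hq : 0 < p ^ k := pow_pos hp.out.pos k
    have hc : ∀ i, ¬ p ^ k ∣ i → f.coeff i = 0 := fun i hi =>
      coeff_eq_zero_of_natDegree_eq_mul_prime_pow p hd hca hi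
    have hQ : (rootPoly p k n f) ^ p ^ k = f := rootPoly_pow p hd hc
    have hQn : (rootPoly p k n f).coeff n = 1 := coeff_rootPoly_self p hf hd
    have hQdeg : (rootPoly p k n f).natDegree = n :=
      natDegree_eq_of_le_of_coeff_ne_zero (natDegree_rootPoly_le p k n f) (by rw [hQn]; exact one_ne_zero)
    have hQmonic : (rootPoly p k n f).Monic :=
      monic_of_natDegree_le_of_coeff_eq_one n (natDegree_rootPoly_le p k n f) hQn
    have hQca : IsCasasAlvero (rootPoly p k n f) := by
      intro j hj0 hjn
      rw [hQdeg] at hjn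
      have hlt : j * p ^ k < f.natDegree := by rw [hd]; exact Nat.mul_lt_mul_of_pos_right hjn hq
      obtain ⟨a, ha1, ha2⟩ := hca (j * p ^ k) (Nat.mul_pos hj0 hq) hlt
      rw [← hQ, eval_pow] at ha1
      rw [← hQ, hasseDeriv_mul_prime_pow_pow p, eval_pow] at ha2
      exact ⟨a, eq_zero_of_pow_prime_pow_eq_zero p ha1, eq_zero_of_pow_prime_pow_eq_zero p ha2⟩
    obtain ⟨a, hQa⟩ := hn _ hQmonic hQdeg hQca
    exact ⟨a, by rw [← hQ, hQa, ← pow_mul]⟩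

end CharP

/-- **GvBLSW Prop. 3, degree 1**: over any commutative ring. [cite: GrafVonBothmerEtAl2007, Prop. 3] -/
theorem holdsInDegree_one : HoldsInDegree R 1 := by
  intro f hf hd _
  exact ⟨-f.coeff 0, by rw [pow_one, map_neg, sub_neg_eq_add]; exact hf.eq_X_add_C hd⟩

/-- **GvBLSW Prop. 3, degree 2**: over any commutative ring — a monic quadratic sharing a root `r` with
its derivative `2X + b` is `(X - r)^2` ("whether `2` is `0` or not"). [cite: GrafVonBothmerEtAl2007, Prop. 3] -/
theorem holdsInDegree_two : HoldsInDegree R 2 := by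
  intro f hf hd hca
  obtain ⟨r, hr, hr'⟩ := hca 1 one_pos (by rw [hd]; norm_num)
  have h2 : f = X ^ 2 + C (f.coeff 1) * X + C (f.coeff 0) := by
    conv_lhs => rw [hf.as_sum, hd]
    simp only [Finset.sum_range_succ, Finset.sum_range_zero, zero_add, pow_zero, mul_one, pow_one]
    ring
  rw [hasseDeriv_one', h2] at hr'
  rw [h2] at hr
  simp only [derivative_add, derivative_X_pow, derivative_mul, derivative_C, derivative_X, zero_mul,
    zero_add, mul_one, add_zero, Nat.cast_ofNat, eval_add, eval_mul, eval_pow, eval_C, eval_X] at hr hr'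
  -- hr : r ^ 2 + f.coeff 1 * r + f.coeff 0 = 0 ;  hr' : 2 * r ^ (2 - 1) + f.coeff 1 = 0
  have hb : f.coeff 1 = -(2 * r) := by
    have := hr'; norm_num at this; linear_combination this
  have hc : f.coeff 0 = r ^ 2 := by linear_combination hr - r * hr' 
  refine ⟨r, ?_⟩
  rw [h2, hb, hc, map_neg, map_mul, map_pow, map_ofNat]
  ring

/-- Degree `3` over a field with `6 ≠ 0`: a monic cubic sharing a root with each of `H_1 f = f'` and
`H_2 f = 3X + [X^2] f` is a cube.  (Elementary.  The hypothesis excludes characteristic `2`, where the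
statement fails — `X^2 (X - 1)` over `𝔽_2`, GvBLSW Prop. 7 — and characteristic `3`, where it holds
over perfect fields by `holdsInDegree_prime_pow` but the argument below divides by `3`.)
[cite: GrafVonBothmerEtAl2007, Prop. 7] -/
theorem holdsInDegree_three {K : Type*} [Field K] (h6 : (6 : K) ≠ 0) : HoldsInDegree K 3 := by
  intro f hf hd hca
  have h2K : (2 : K) ≠ 0 := fun h => h6 (by rw [show (6 : K) = 2 * 3 by norm_num, h, zero_mul])
  obtain ⟨s, hs, hs'⟩ := hca 1 one_pos (by rw [hd]; norm_num)
  obtain ⟨t, ht, ht'⟩ := hca 2 (by norm_num) (by rw [hd]; norm_num)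
  set c0 := f.coeff 0 with hc0d
  set c1 := f.coeff 1 with hc1d
  set c2 := f.coeff 2 with hc2d
  have h3 : f = X ^ 3 + C c2 * X ^ 2 + C c1 * X + C c0 := by
    conv_lhs => rw [hf.as_sum, hd]
    simp only [Finset.sum_range_succ, Finset.sum_range_zero, zero_add, pow_zero, mul_one, pow_one]
    ring
  have hf3 : f.coeff 3 = 1 := by rw [← hd]; exact hf.coeff_natDegree
  -- H_2 f = 3 X + c2, computed coefficientwise
  have hH2 : hasseDeriv 2 f = C (3 : K) * X + C c2 := by
    ext m
    rw [hasseDeriv_coeff, coeff_add, coeff_C_mul_X, coeff_C]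
    rcases m with _ | _ | m
    · simp [hc2d]
    · norm_num [hf3, Nat.choose]
    · rw [if_neg (by omega), if_neg (by omega), add_zero,
        coeff_eq_zero_of_natDegree_lt (by rw [hd]; omega), mul_zero]
  rw [hH2] at ht'
  rw [hasseDeriv_one', h3] at hs'
  rw [h3] at hs ht
  simp only [derivative_add, derivative_X_pow, derivative_mul, derivative_C, derivative_X, zero_mul,
    zero_add, mul_one, add_zero, Nat.cast_ofNat, eval_add, eval_mul, eval_pow, eval_C, eval_X] at hs hs' ht ht'
  norm_num at hs hs' ht ht'
  -- hs : s^3 + c2 s^2 + c1 s + c0 = 0; hs' : 3 s^2 + 2 c2 s + c1 = 0 (up to normalisation);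
  -- ht : t^3 + c2 t^2 + c1 t + c0 = 0; ht' : 3 t + c2 = 0
  have hu : 2 * (s - t) ^ 3 = 0 := by linear_combination (s - t) * hs' - hs + ht - (s - t) ^ 2 * ht'
  have hst : s = t := by
    rcases mul_eq_zero.mp hu with h | h
    · exact absurd h h2K
    · exact sub_eq_zero.mp (pow_eq_zero_iff (by norm_num) |>.mp h)
  subst hst
  have hc2 : c2 = -(3 * s) := by linear_combination ht'
  have hc1 : c1 = 3 * s ^ 2 := by linear_combination hs' - 2 * s * ht'
  have hc0 : c0 = -s ^ 3 := by linear_combination ht - s ^ 2 * ht' - s * hc1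
  refine ⟨s, ?_⟩
  rw [h3, hc2, hc1, hc0, map_neg, map_neg, map_mul, map_mul, map_pow, map_pow, map_ofNat]
  ring

/-- Degree `3 · p^k` over a perfect field of characteristic `p ≥ 5` (the characteristic-`p` half of the
known case `d = 3p^k, p ≠ 2, 3` — `p = 3` being the prime-power case `3^(k+1)`).
[cite: GrafVonBothmerEtAl2007, Prop. 6; CastryckLaterveerOunaies2012, §1] -/
theorem holdsInDegree_three_mul_prime_pow {K : Type*} [Field K] (p : ℕ) [Fact p.Prime] [CharP K p]
    [PerfectRing K p] (hp5 : 5 ≤ p) (k : ℕ) : HoldsInDegree K (3 * p ^ k) := by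
  refine holdsInDegree_mul_prime_pow p (holdsInDegree_three ?_) k
  intro h6
  have h6' : ((6 : ℕ) : K) = 0 := by exact_mod_cast h6
  rw [CharP.cast_eq_zero_iff K p] at h6'
  have : p ≤ 6 := Nat.le_of_dvd (by norm_num) h6'
  interval_cases p <;> simp_all (config := {decide := true})

end Literature.Algebra.Polynomial.CasasAlvero
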